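import Mathlib
import Summits.Ventures.HodgeRepro2.T5CyclotomicTwentyOneCensus
import Summits.Ventures.HodgeRepro2.T5SexticRecordSatake

/-!
# THE SATAKE CHAIN OF THE RECORD'S PAIR ON THE NON-CYCLOTOMIC FIELD `F = ℚ(ζ₂₁)^{⟨σ₁₃⟩}` AT `2`, `5` AND `41`, AS NUMERALS

Tier-5 support N3 / §G-N4.2 (seat p3, gen 81). File 289 reads the census of `F` — `2` and `5` are inert (`f(P/p) = 6`,
`f(v/p) = 3`, `N(v) = 8`, `125`); `41` has `f(P/41) = 2`, `f(v/41) = 1`, `N(v) = 41`. File 282's theorem with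
`q = p^{f(v/p)}` gives the Satake chain there, for every hermitian `H ∈ M₃(F)` with unit determinant good above `v`,
every generator family `l` and every field `k` of characteristic `0` — the chain's hypothesis set is thereby inhabited
on a third field, the first NON-CYCLOTOMIC one (`ℚ(i)`, `ℚ(ζ₇)`, `ℚ(ζ₉)` before):

* `ChainNumerals K v l k H q c₁ c₂ c₃` (the chain with numerals, a `Prop`) and **`chainNumerals_of_map_eq`** (it holds
  at every place that stays prime, for every CM field, with `q = p^{f(v/p)}`, `c₁ = q³ + 1`, `c₂ = q⁴`, `c₃ = q⁴ + q`);
* **`chainNumerals_two`** — `q = 8`: `deg Tₙ = 513 · 8^{4n−3}` (`deg T₁ = 4104`),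
  `T₁ T_{n+2} = T_{n+3} + 7 T_{n+2} + 4096 T_{n+1}`, `T₁² = T₂ + 7 T₁ + 4104 T₀`;
* **`chainNumerals_five`** — `q = 125`: `deg Tₙ = 1953126 · 125^{4n−3}`,
  `T₁ T_{n+2} = T_{n+3} + 124 T_{n+2} + 244140625 T_{n+1}`, `T₁² = T₂ + 124 T₁ + 244140750 T₀`;
* **`chainNumerals_fortyOne`** — `q = 41`: `deg Tₙ = 68922 · 41^{4n−3}`
  (`deg T₁ = 2825802`), `T₁ T_{n+2} = T_{n+3} + 40 T_{n+2} + 2825761 T_{n+1}`, `T₁² = T₂ + 40 T₁ + 2825802 T₀`.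

Method: the chain with numerals `q, q³ + 1, q⁴, q⁴ + q` is packaged as the `Prop` `ChainNumerals K v l k H q c₁ c₂ c₃`
(a statement of this seat, not a cited fact), proved for EVERY CM field at every place that stays prime from file 282
(`chainNumerals_of_map_eq`: `q = p^{f(v/p)}`, the numerals as hypotheses discharged by `norm_num`); on `F` the type
`↥(fixedField L)` makes the instance search for the orbit action exceed the default heartbeats when the statement is
spelled out, so the instantiations apply the packaged `Prop` (its instances are terms, no search). The CM-field
structure of `F` is file 288's theorem `isCMField_fixedField`, supplied by `haveI` inside the statements (as file 283
does for `ℚ(ζ₉)`); `inertiaDeg_under_eq` reads `f(v/p)` off `f(P/p)` by the tower law at a non-split place.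

§8(d): uses an L-value-free non-vanishing device: NO.
-/

open Matrix NumberField NumberField.IsCMField IsDedekindDomain IsDedekindDomain.HeightOneSpectrum Module Polynomial
  MulAction
open scoped TensorProduct Pointwise
open Summit.Ventures.HodgeRepro2.T5UnitaryGroupForm Summit.Ventures.HodgeRepro2.T5UnitaryHeckeAdjoint
  Summit.Ventures.HodgeRepro2.T5HeckePermutationModule Summit.Ventures.HodgeRepro2.T5HeckeDoubleCoset
  Summit.Ventures.HodgeRepro2.T5RecordHyperspecial Summit.Ventures.HodgeRepro2.T5GlobalLatticeAlmostAll
  Summit.Ventures.HodgeRepro2.T5FinitePlaceSplitClassification Summit.Ventures.HodgeRepro2.T5RecordSatakeIntrinsic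
  Summit.Ventures.HodgeRepro2.T5CMFieldSquareDatum Summit.Ventures.HodgeRepro2.T5RecordSatakeToy
  Summit.Ventures.HodgeRepro2.T5SplitPlaceUnitaryGroup Summit.Ventures.HodgeRepro2.T5NonSplitPlaceUnitaryGroup
  Summit.Ventures.HodgeRepro2.T5FinitePlaceCM Summit.Ventures.HodgeRepro2.T5StarOfInvolution
  Summit.Ventures.HodgeRepro2.T5RecordSatake Summit.Ventures.HodgeRepro2.T5RecordSatakeInert
  Summit.Ventures.HodgeRepro2.T5RecordSatakeInertToyDegree Summit.Ventures.HodgeRepro2.T5RecordSatakeDegreeCells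
  Summit.Ventures.HodgeRepro2.T5CyclotomicSevenHeckeCommutative
  Summit.Ventures.HodgeRepro2.T5CMFieldCyclicGaloisCriterion Summit.Ventures.HodgeRepro2.T5SexticRecordSatake
  Summit.Ventures.HodgeRepro2.T5CyclotomicTwentyOneSextic Summit.Ventures.HodgeRepro2.T5CyclotomicTwentyOneCensus

namespace Summit.Ventures.HodgeRepro2.T5CyclotomicTwentyOneSatake

section Numerals

variable (K : Type*) [Field K] [NumberField K] [IsCMField K]
variable (v : HeightOneSpectrum (𝓞 (maximalRealSubfield K)))

/-- **The Satake chain of the record's pair at `v` with the numerals `q`, `c₁ = q³ + 1`, `c₂ = q⁴`, `c₃ = q⁴ + q`**: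
cells `gₙ ∈ U(1 ⊗ H)` with `deg Tₙ = c₁ · q^{4n−3}` (`n ≥ 1`), `deg T₀ = 1`, `T₁ T_{n+2} = T_{n+3} + (q − 1) T_{n+2} +
c₂ T_{n+1}` and `T₁² = T₂ + (q − 1) T₁ + c₃ T₀` — file 282's conclusion with its numbers abstracted (a statement of
this seat, not a cited fact). -/
def ChainNumerals {r : ℕ} (l : Fin r → 𝓞 K) (k : Type*) [Field k] [CharZero k]
    (H : Matrix (Fin 3) (Fin 3) K) (q c₁ c₂ c₃ : ℕ) : Prop :=
  ∃ g : ℕ → (letI := tensorStarRing K v; ↥(formUnitaryGroup (tensorGram K v H))),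
    (∀ n, 1 ≤ n → (orbit (recordHyperspecial K v l H)
      (g n : _ ⧸ recordHyperspecial K v l H)).ncard = c₁ * q ^ (4 * n - 3)) ∧
    (orbit (recordHyperspecial K v l H) (g 0 : _ ⧸ recordHyperspecial K v l H)).ncard = 1 ∧
    ∃ hfin : ∀ n, Finite (orbit (recordHyperspecial K v l H) (g n : _ ⧸ recordHyperspecial K v l H)),
      (∀ n, letI := hfin 1; letI := hfin (n + 1 + 1); letI := hfin (n + 1 + 1 + 1); letI := hfin (n + 1);
        doubleCosetOp k (recordHyperspecial K v l H) (g 1) *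
            doubleCosetOp k (recordHyperspecial K v l H) (g (n + 1 + 1)) =
          doubleCosetOp k (recordHyperspecial K v l H) (g (n + 1 + 1 + 1)) +
            ((q - 1 : ℕ) : k) • doubleCosetOp k (recordHyperspecial K v l H) (g (n + 1 + 1)) +
            (c₂ : k) • doubleCosetOp k (recordHyperspecial K v l H) (g (n + 1))) ∧
      (letI := hfin 1; letI := hfin (0 + 1); letI := hfin (0 + 1 + 1); letI := hfin 0;
        doubleCosetOp k (recordHyperspecial K v l H) (g 1) *
            doubleCosetOp k (recordHyperspecial K v l H) (g (0 + 1)) =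
          doubleCosetOp k (recordHyperspecial K v l H) (g (0 + 1 + 1)) +
            ((q - 1 : ℕ) : k) • doubleCosetOp k (recordHyperspecial K v l H) (g (0 + 1)) +
            (c₃ : k) • doubleCosetOp k (recordHyperspecial K v l H) (g 0))

variable (p : ℕ) [hp : Fact p.Prime] [hv : v.asIdeal.LiesOver (Ideal.span {(p : ℤ)})]

/-- **THE CHAIN WITH NUMERALS AT EVERY PLACE THAT STAYS PRIME** (file 282 read with `q = p^{f(v/p)}` and the four
numbers supplied as hypotheses): for every CM field `K`, every place `v` of `K⁺` above `p` with `v 𝓞_K = w`, every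
hermitian `H` with unit determinant and `w ∉ badSet H`, every generator family `l`, every field `k` of characteristic
`0`, and every `q, c₁, c₂, c₃` with `q = p^{f(v/p)}`, `c₁ = q³ + 1`, `c₂ = q⁴`, `c₃ = q⁴ + q`. -/
theorem chainNumerals_of_map_eq (w : HeightOneSpectrum (𝓞 K))
    (hmap : Ideal.map (algebraMap (𝓞 (maximalRealSubfield K)) (𝓞 K)) v.asIdeal = w.asIdeal)
    {r : ℕ} (l : Fin r → 𝓞 K) (k : Type*) [Field k] [CharZero k]
    (hl : Submodule.span (𝓞 (maximalRealSubfield K)) (Set.range l) = ⊤)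
    {H : Matrix (Fin 3) (Fin 3) K} (hH : H.IsHermitian) (hdet : IsUnit H.det) (hbad : w ∉ badSet H)
    (q c₁ c₂ c₃ : ℕ) (hq : p ^ v.asIdeal.inertiaDeg ℤ = q) (h1 : q ^ 3 + 1 = c₁) (h2 : q ^ 4 = c₂)
    (h3 : q ^ 4 + q = c₃) :
    ChainNumerals K v l k H q c₁ c₂ c₃ := by
  have hq1 : 1 ≤ q := by
    rw [← hq]
    exact Nat.one_le_pow _ _ hp.out.pos
  have e1 : (p : k) ^ v.asIdeal.inertiaDeg ℤ - 1 = ((q - 1 : ℕ) : k) := by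
    rw [Nat.cast_sub hq1, ← hq, Nat.cast_pow, Nat.cast_one]
  have e2 : ((p : k) ^ v.asIdeal.inertiaDeg ℤ) ^ 4 = (c₂ : k) := by
    rw [← h2, ← hq, Nat.cast_pow, Nat.cast_pow]
  have e3 : ((p : k) ^ v.asIdeal.inertiaDeg ℤ) ^ 4 + (p : k) ^ v.asIdeal.inertiaDeg ℤ = (c₃ : k) := by
    rw [← h3, ← hq, Nat.cast_add, Nat.cast_pow, Nat.cast_pow]
  have key := T5SexticRecordSatake.exists_cells_ncard_and_three_term_record_of_map_eq K p v w hmap l k hl hH hdet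
    hbad
  refine key.elim fun g hg => ⟨g, fun n hn' => ?_, hg.2.1, ?_⟩
  · rw [hg.1 n hn', hq, h1]
  · refine hg.2.2.elim fun hfin hh => ⟨hfin, fun n => ?_, ?_⟩
    · exact three_term_congr e1 e2 (hh.1 n)
    · exact three_term_congr e1 e3 hh.2

end Numerals

section Chain

variable (L : Type*) [Field L] [NumberField L] [IsCyclotomicExtension {21} ℚ L]

/-- **`f(v/p) = f(P/p) / 2` at a place of `F⁺` under a prime `P` of `F` with `f(P/p)` even** (`p ∤ 21`): the place
is non-split (file 281) and `f(P/p) = 2 f(v/p)` (file 282). -/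
theorem inertiaDeg_under_eq (p : ℕ) [hp : Fact p.Prime] (hpm : p.Coprime 21)
    (P : Ideal (𝓞 (fixedField L))) [hP : P.IsPrime] [hPp : P.LiesOver (Ideal.span {(p : ℤ)})]
    (v : HeightOneSpectrum (𝓞 (maximalRealSubfield (fixedField L)))) [hPv : P.LiesOver v.asIdeal]
    (heven : Even (P.inertiaDeg ℤ)) :
    P.inertiaDeg ℤ = 2 * v.asIdeal.inertiaDeg ℤ := by
  haveI := isCMField_fixedField L
  haveI := isGalois_fixedField L
  haveI := isCyclic_gal_fixedField L
  have he : P.ramificationIdx ℤ = 1 :=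
    T5CyclotomicUnramified.ramificationIdx_eq_one (m := 21) p L (fixedField L)
      ((Nat.Prime.coprime_iff_not_dvd hp.out).mp hpm) P
  have h1 : (v.asIdeal.primesOver (𝓞 (fixedField L))).ncard = 1 :=
    (T5CMFieldCyclicGaloisCriterion.ncard_primesOver_eq_one_iff_even_inertiaDeg (fixedField L) p P v he).mpr heven
  exact T5SexticRecordSatake.inertiaDeg_eq_two_mul_of_ncard_eq_one (fixedField L) v P he h1

/-- **THE SATAKE CHAIN OF THE RECORD'S PAIR AT THE PLACES OF `F⁺` ABOVE `2`, `q = 8`**: `deg Tₙ = 513 · 8^{4n−3}`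
(`n ≥ 1`), `deg T₀ = 1`, `T₁ T_{n+2} = T_{n+3} + 7 T_{n+2} + 4096 T_{n+1}`, `T₁² = T₂ + 7 T₁ + 4104 T₀`, for every
hermitian `H` with unit determinant good above `v`, every generator family `l` and every field `k` of characteristic `0`
(`f(v/2) = 3`; `2` is inert in `F`). -/
theorem chainNumerals_two (P : Ideal (𝓞 (fixedField L))) [hP : P.IsPrime]
    [hPp : P.LiesOver (Ideal.span {(2 : ℤ)})]
    (v : HeightOneSpectrum (𝓞 (maximalRealSubfield (fixedField L)))) [hPv : P.LiesOver v.asIdeal]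
    {r : ℕ} (l : Fin r → 𝓞 (fixedField L)) (k : Type*) [Field k] [CharZero k]
    (hl : Submodule.span (𝓞 (maximalRealSubfield (fixedField L))) (Set.range l) = ⊤) :
    haveI := isCMField_fixedField L
    ∀ {H : Matrix (Fin 3) (Fin 3) (fixedField L)}, H.IsHermitian → IsUnit H.det →
    (∀ w : HeightOneSpectrum (𝓞 (fixedField L)), w.asIdeal.LiesOver v.asIdeal → w ∉ badSet H) →
    ChainNumerals (fixedField L) v l k H 8 513 4096 4104 := by
  haveI := isCMField_fixedField L
  intro H hH hdet hbad
  haveI : Fact (Nat.Prime 2) := ⟨by norm_num⟩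
  haveI : v.asIdeal.LiesOver (Ideal.span {(2 : ℤ)}) := Ideal.LiesOver.tower_bot P v.asIdeal _
  have hst := census_two L P v
  have hf : P.inertiaDeg ℤ = 6 := hst.1
  have hvf : v.asIdeal.inertiaDeg ℤ = 3 := by
    have h2 := inertiaDeg_under_eq L 2 (by decide) P v (by rw [hf]; decide)
    omega
  refine hst.2.2.elim fun w hmap => ?_
  refine chainNumerals_of_map_eq (fixedField L) v 2 w hmap l k hl hH hdet
    (hbad w (liesOver_of_map_eq (fixedField L) v w hmap)) 8 513 4096 4104 ?_ (by norm_num) (by norm_num)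
    (by norm_num)
  rw [hvf]
  norm_num

/-- **THE SATAKE CHAIN OF THE RECORD'S PAIR AT THE PLACES OF `F⁺` ABOVE `5`, `q = 125`**: `deg Tₙ = 1953126 · 125^{4n−3}`
(`n ≥ 1`), `deg T₀ = 1`, `T₁ T_{n+2} = T_{n+3} + 124 T_{n+2} + 244140625 T_{n+1}`, `T₁² = T₂ + 124 T₁ + 244140750 T₀`, for every
hermitian `H` with unit determinant good above `v`, every generator family `l` and every field `k` of characteristic `0`
(`f(v/5) = 3`; `5` is inert in `F`). -/
theorem chainNumerals_five (P : Ideal (𝓞 (fixedField L))) [hP : P.IsPrime]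
    [hPp : P.LiesOver (Ideal.span {(5 : ℤ)})]
    (v : HeightOneSpectrum (𝓞 (maximalRealSubfield (fixedField L)))) [hPv : P.LiesOver v.asIdeal]
    {r : ℕ} (l : Fin r → 𝓞 (fixedField L)) (k : Type*) [Field k] [CharZero k]
    (hl : Submodule.span (𝓞 (maximalRealSubfield (fixedField L))) (Set.range l) = ⊤) :
    haveI := isCMField_fixedField L
    ∀ {H : Matrix (Fin 3) (Fin 3) (fixedField L)}, H.IsHermitian → IsUnit H.det →
    (∀ w : HeightOneSpectrum (𝓞 (fixedField L)), w.asIdeal.LiesOver v.asIdeal → w ∉ badSet H) →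
    ChainNumerals (fixedField L) v l k H 125 1953126 244140625 244140750 := by
  haveI := isCMField_fixedField L
  intro H hH hdet hbad
  haveI : Fact (Nat.Prime 5) := ⟨by norm_num⟩
  haveI : v.asIdeal.LiesOver (Ideal.span {(5 : ℤ)}) := Ideal.LiesOver.tower_bot P v.asIdeal _
  have hst := census_five L P v
  have hf : P.inertiaDeg ℤ = 6 := hst.1
  have hvf : v.asIdeal.inertiaDeg ℤ = 3 := by
    have h2 := inertiaDeg_under_eq L 5 (by decide) P v (by rw [hf]; decide)
    omega
  refine hst.2.2.elim fun w hmap => ?_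
  refine chainNumerals_of_map_eq (fixedField L) v 5 w hmap l k hl hH hdet
    (hbad w (liesOver_of_map_eq (fixedField L) v w hmap)) 125 1953126 244140625 244140750 ?_ (by norm_num) (by norm_num)
    (by norm_num)
  rw [hvf]
  norm_num

/-- **THE SATAKE CHAIN OF THE RECORD'S PAIR AT THE PLACES OF `F⁺` ABOVE `41`, `q = 41`**: `deg Tₙ = 68922 · 41^{4n−3}`
(`n ≥ 1`), `deg T₀ = 1`, `T₁ T_{n+2} = T_{n+3} + 40 T_{n+2} + 2825761 T_{n+1}`, `T₁² = T₂ + 40 T₁ + 2825802 T₀`, for every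
hermitian `H` with unit determinant good above `v`, every generator family `l` and every field `k` of characteristic `0`
(`f(v/41) = 1`; a degree-one inert place). -/
theorem chainNumerals_fortyOne (P : Ideal (𝓞 (fixedField L))) [hP : P.IsPrime]
    [hPp : P.LiesOver (Ideal.span {(41 : ℤ)})]
    (v : HeightOneSpectrum (𝓞 (maximalRealSubfield (fixedField L)))) [hPv : P.LiesOver v.asIdeal]
    {r : ℕ} (l : Fin r → 𝓞 (fixedField L)) (k : Type*) [Field k] [CharZero k]
    (hl : Submodule.span (𝓞 (maximalRealSubfield (fixedField L))) (Set.range l) = ⊤) :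
    haveI := isCMField_fixedField L
    ∀ {H : Matrix (Fin 3) (Fin 3) (fixedField L)}, H.IsHermitian → IsUnit H.det →
    (∀ w : HeightOneSpectrum (𝓞 (fixedField L)), w.asIdeal.LiesOver v.asIdeal → w ∉ badSet H) →
    ChainNumerals (fixedField L) v l k H 41 68922 2825761 2825802 := by
  haveI := isCMField_fixedField L
  intro H hH hdet hbad
  haveI : Fact (Nat.Prime 41) := ⟨by norm_num⟩
  haveI : v.asIdeal.LiesOver (Ideal.span {(41 : ℤ)}) := Ideal.LiesOver.tower_bot P v.asIdeal _
  have hst := census_fortyOne L P v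
  have hf : P.inertiaDeg ℤ = 2 := hst.1
  have hvf : v.asIdeal.inertiaDeg ℤ = 1 := by
    have h2 := inertiaDeg_under_eq L 41 (by decide) P v (by rw [hf]; decide)
    omega
  refine hst.2.2.elim fun w hmap => ?_
  refine chainNumerals_of_map_eq (fixedField L) v 41 w hmap l k hl hH hdet
    (hbad w (liesOver_of_map_eq (fixedField L) v w hmap)) 41 68922 2825761 2825802 ?_ (by norm_num) (by norm_num)
    (by norm_num)
  rw [hvf]
  norm_num

end Chain

end Summit.Ventures.HodgeRepro2.T5CyclotomicTwentyOneSatake
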